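import Summits.CriticalPhenomena.PercolationContinuityZ3.Theorems.PercNearOneGluingNoHeavyQuantGatedSliceMixLawCells
import HarnessLib

/-!
# QUANT lane R8, T-DEC, leg (III), blob case — `LawDec.MixLawCellQ3` IS FALSE: the unsaturated-mid cell of the moved two-point law is NOT a
# θ = 0 cell (kernel refutation of record; witness census-2 g61, independent kernel countersign ARM-REF g83)

builds on p205010 (kernel theorem, internal audit signed; external expert review pending)

Support file (`--supports stmt-CriticalPhenomena-4575`), QUANT lane seat prim-quant-census-2 (gen 61), rung R8 of
`run/shared/lean/prim/quant/LADDER.md`.  Memo `run/shared/lean/prim/quant/prim-quant-census-2-g61/REGIME-B-TOP-G61.md` §1.  Theorems only,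
standard axioms, no sorries.  The Lean text of the weak-duality certificate is ARM-REF g83's probe (`quant/prim-quant-arm-4-g83/probe_g83_Q3.lean`,
report ARM-REF-G83.md), adapted to the tree's namespace; the witness and its exact census are census-2 g61's (INBOX 2026-08-23 l.1032).

THE WITNESS.  `y = 15/26, z = 0, g = 3/5, S = 15/2, λ = 9/20, a = 1, j = M = 13, k₁ = 3, k₂ = 13` (so `t = 81/10`, `ℓ = 4`,
`P = (11/50)δ₃ + (33/100)δ₄ + (9/50)δ₁₃ + (27/100)δ₁₄`).  Every hypothesis of `MixLawCellQ3` holds — in particular the mid `13` is NOT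
saturated by the shifted low (`(33/100)·usage(4,13) = 0.1681… ≤ 9/50`) — yet `P` is not `DECAtT (15/26) (81/10) 13 14`: weak duality
(`LawDec.dual_le_of_decAtT`) with the prices `α₃ = usage(3,13) = 14253/19547`, `α₄ = usage(4,13) = 2567/5038`, `β₁₃ = 1`,
`β₁₄ = usage(3,13)/usage(3,14) = 4751/8885`, `β = 100` on the uncharged mids gives the dual value `1069617/3255464 > 288207/888500`.
MECHANISM: the heavy unshifted low `k₁ = 3` (mass `0.22`) is CHEAP at the mid (light pair) and, together with the shifted low, over-fills it;
the giant `14` cannot take the rest (`0.2778 > 0.27`).  The corrected θ = 0 cells are `MixLawCellPDear` / `MixLawCellPCheap`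
(`…QuantGatedSliceMixLawRegimeBCells`): the mid must be unsaturated by the lows that PREFER it; where it is saturated the weak-mid law is mixed in
(`…QuantGatedSliceMixLawRegimeBTop`, typer's `MixLawCellA5`).  Family of the witness (exact hunt, seat code `q3hunt.py`): TA-tight floors,
`a ∈ {1,2}`, `k₁ ∈ {3,…,6}`, `g ≈ 0.55–0.6`, `λ = 9/20`, first at `M = 13`; none below `M = 13` on the `/20` grid.

* `LawDec.MixLawQ3Witness.P_not_dec` — the moved law of the witness is not `DECAtT`.
* **`LawDec.not_mixLawCellQ3`** — `¬ MixLawCellQ3`.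

[this work]; Farkas / weak duality for the flow form: prim-quant-stmt g22 (`dual_le_of_decAtT`, this lane).  Nothing here is cited as a published
result.  The gluing rows served [cite: KozmaNitzan2024, Conjecture 3 (p. 15)]; product measure [cite: Grimmett1999, §1.3 p. 10].
-/

noncomputable section

namespace Summit.CriticalPhenomena.PercolationContinuityZ3.Theorems

namespace Quant

open Finset

namespace LawDec

namespace MixLawQ3Witness

/-- the rate of a compatible mid pair is at least its `ρ` (witness frame `y = 15/26`, `t = 81/10`, `j = 13`). [this work] -/
theorem usage_ge_rho (l h : ℕ) (hlow : 2 * (l : ℝ) < 81/10) (hcomp : (81/10 : ℝ) < (l : ℝ) + h) (hh : ¬ 13 + 1 ≤ h) :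
    (81/10 - 2 * (l : ℝ)) / ((h : ℝ) - l) ≤ usage (15/26) (81/10) 13 l h := by
  have hlt : l < h := by
    by_contra hcon
    push Not at hcon
    have : (h : ℝ) ≤ l := by exact_mod_cast hcon
    linarith
  have hG0 := pairGate_pos (15/26) (81/10) l h hlow hlt
  have hG1 := pairGate_lt_one (15/26) (81/10) l h (by norm_num) (by norm_num) hlow hcomp
  have hρ : (81/10 - 2 * (l : ℝ)) / ((h : ℝ) - l) ≤ pairGate (15/26) (81/10) l h := le_max_left _ _
  simp only [usage, gateOf, if_neg hh]
  refine hρ.trans ?_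
  rw [le_div_iff₀ (by linarith)]
  nlinarith

/-- the rate of a compatible pair is nonnegative (witness frame). [this work] -/
theorem usage_nonneg' (l h : ℕ) (hlow : 2 * (l : ℝ) < 81/10) (hcomp : 13 + 1 ≤ h ∨ (81/10 : ℝ) < (l : ℝ) + h) :
    0 ≤ usage (15/26) (81/10) 13 l h := by
  by_cases hg : 13 + 1 ≤ h
  · simp only [usage, gateOf, if_pos hg]; norm_num
  · rcases hcomp with hc | hc
    · exact absurd hc hg
    · have hlt : l < h := by
        by_contra hcon
        push Not at hcon
        have : (h : ℝ) ≤ l := by exact_mod_cast hcon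
        linarith
      have hG0 := pairGate_pos (15/26) (81/10) l h hlow hlt
      have hG1 := pairGate_lt_one (15/26) (81/10) l h (by norm_num) (by norm_num) hlow hc
      simp only [usage, gateOf, if_neg hg]
      exact div_nonneg hG0.le (by linarith)

/-- **the price system is feasible**: `α l ≤ usage(l,h)·β h` on every compatible pair, with `α₃ = 14253/19547`, `α₄ = 2567/5038` (else `0`),
`β₁₃ = 1`, `β₁₄ = 4751/8885`, `β = 100` on the other mids. [this work] -/
theorem prices_feasible : ∀ (l h : ℕ), l ≤ 13 → 2 * (l : ℝ) < 81/10 → h ≤ 13 + 1 →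
    (13 + 1 ≤ h ∨ (81/10 : ℝ) < (l : ℝ) + h) →
    (fun l : ℕ => if l = 3 then (14253/19547 : ℝ) else if l = 4 then 2567/5038 else 0) l
      ≤ usage (15/26) (81/10) 13 l h * (fun h : ℕ => if h = 13 then (1 : ℝ) else if h = 14 then 4751/8885 else 100) h := by
  intro l h hl hl2 hM hc
  have hl4 : l ≤ 4 := by
    by_contra hcon
    push Not at hcon
    have : (5 : ℝ) ≤ (l : ℝ) := by exact_mod_cast hcon
    linarith
  have hu0 := usage_nonneg' l h hl2 hc
  have hβ0 : 0 ≤ (fun h : ℕ => if h = 13 then (1 : ℝ) else if h = 14 then 4751/8885 else 100) h := by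
    dsimp only; split_ifs <;> norm_num
  by_cases h34 : l = 3 ∨ l = 4
  · by_cases hg : 13 + 1 ≤ h
    · have hh : h = 14 := by omega
      subst hh
      rcases h34 with rfl | rfl <;> norm_num [usage, gateOf]
    · rcases hc with hc | hc
      · exact absurd hc hg
      · by_cases h13 : h = 13
        · subst h13
          rcases h34 with rfl | rfl <;> norm_num [usage, gateOf, pairGate, max_def]
        · have hh12 : h ≤ 12 := by omega
          have hρ := usage_ge_rho l h hl2 hc hg
          have h14 : h ≠ 14 := by omega
          simp only [if_neg h13, if_neg h14]
          have hhr : (h : ℝ) ≤ 12 := by exact_mod_cast hh12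
          have hhl : (l : ℝ) < h := by
            have : l < h := by
              by_contra hcon; push Not at hcon
              have : (h : ℝ) ≤ l := by exact_mod_cast hcon
              linarith
            exact_mod_cast this
          rcases h34 with rfl | rfl
          · have hρ' : (1/80 : ℝ) ≤ (81/10 - 2 * ((3 : ℕ) : ℝ)) / ((h : ℝ) - (3 : ℕ)) := by
              rw [le_div_iff₀ (by push_cast at hhl ⊢; linarith)]; push_cast at hhl hhr ⊢; linarith
            have hu : (1/80 : ℝ) ≤ usage (15/26) (81/10) 13 3 h := hρ'.trans hρ
            norm_num
            linarith
          · have hρ' : (1/80 : ℝ) ≤ (81/10 - 2 * ((4 : ℕ) : ℝ)) / ((h : ℝ) - (4 : ℕ)) := by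
              rw [le_div_iff₀ (by push_cast at hhl ⊢; linarith)]; push_cast at hhl hhr ⊢; linarith
            have hu : (1/80 : ℝ) ≤ usage (15/26) (81/10) 13 4 h := hρ'.trans hρ
            norm_num
            linarith
  · push Not at h34
    have hα : (fun l : ℕ => if l = 3 then (14253/19547 : ℝ) else if l = 4 then 2567/5038 else 0) l = 0 := by
      simp [h34.1, h34.2]
    rw [hα]
    exact mul_nonneg hu0 hβ0

/-- **the moved two-point law of the witness is NOT `DECAtT` at `(15/26, 81/10, 13, 14)`** (weak duality with the prices of
`prices_feasible`: dual value `1069617/3255464 > 288207/888500`). [this work] -/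
theorem P_not_dec :
    ¬ DECAtT (15/26) (81/10) 13 14
      (fun p => (0 : ℝ) * (if p = 0 then (1 : ℝ) else 0)
        + (1 - 0) * slice (fun q => (9/20 : ℝ) * (if q = 13 then (1 : ℝ) else 0)
            + (1 - (9/20 : ℝ)) * (if q = 3 then (1 : ℝ) else 0)) 1 (3/5) p) := by
  intro hD
  have key := dual_le_of_decAtT (15/26) (81/10) 13 14 _ (by norm_num) (by norm_num) hD
    (fun l : ℕ => if l = 3 then (14253/19547 : ℝ) else if l = 4 then 2567/5038 else 0)
    (fun h : ℕ => if h = 13 then (1 : ℝ) else if h = 14 then 4751/8885 else 100)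
    (fun h => by split_ifs <;> norm_num) prices_feasible
  norm_num [Finset.sum_range_succ, slice] at key

end MixLawQ3Witness

/-- the two-point law `{lo, hi; g}` (as in `…QuantLawDEC`) -/
local notation3 "TP[" lo ", " hi ", " g ", " h "]" =>
  (g : ℝ) * (if (h : ℕ) = (hi : ℕ) then (1 : ℝ) else 0) + (1 - (g : ℝ)) * (if (h : ℕ) = (lo : ℕ) then (1 : ℝ) else 0)

/-- **`MixLawCellQ3` IS FALSE**: the θ = 0 cell "unsaturated mid ⟹ the moved law is DEC" fails at `y = 15/26, z = 0, g = 3/5, S = 15/2,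
λ = 9/20, a = 1, j = M = 13, k₁ = 3, k₂ = 13` (witness census-2 g61; kernel countersign ARM-REF g83).  The corrected cells are
`MixLawCellPDear` / `MixLawCellPCheap`. [this work] -/
theorem not_mixLawCellQ3 : ¬ MixLawCellQ3 := by
  intro H
  have key := H (15/26) 0 (3/5) (15/2) (9/20) 1 13 13 3 13
    (by norm_num) (by norm_num) (by norm_num) (by norm_num) (by norm_num) (by norm_num) (by norm_num) (by norm_num)
    (by norm_num) (by norm_num) (by norm_num) (by norm_num) (by norm_num) (by norm_num) (by norm_num) (by norm_num)
    (by norm_num) (by norm_num) (by norm_num) (by norm_num) (by norm_num) (by norm_num) (by norm_num)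
    (by norm_num [usage, gateOf, pairGate, max_def])
  refine MixLawQ3Witness.P_not_dec ?_
  have h81 : (15/2 : ℝ) + ((1 : ℕ) : ℝ) * (3/5) * (1 - 0) = 81/10 := by norm_num
  have hM : (13 + 1 : ℕ) = 14 := rfl
  rw [h81, hM] at key
  exact key

end LawDec

end Quant

end Summit.CriticalPhenomena.PercolationContinuityZ3.Theorems
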